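import Summits.ResolutionOfSingularities.ResolutionOfSingularities.Theorems.EquisingularLiftEquisingularLiftNatOccursAsSingularLocusTransversal
import Summits.ResolutionOfSingularities.ResolutionOfSingularities.Theorems.EquisingularLiftEquisingularLiftNatEquimultipleAlongTraceRegular
import Literature.AlgebraicGeometry.Resolution.BlowupAlgebraPresentation
import Literature.AlgebraicGeometry.Resolution.BlowupDimension
import Literature.AlgebraicGeometry.Resolution.RegularSequenceSpread
import HarnessLib

/-!
# [OURS · L1 W4.5(b)] L-ORD2, part 1 (one chart): the strict transforms of a presented `I²`-system
# are a linear system on the blow-up chart; Bertini upstairs — crux `EquisingularLiftNat` (EL♮,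
# stmt-ResolutionOfSingularities-20038), line `sections`, research stub `stub_elnat_three` / T-ORD

NOT a statement of any manuscript. Object (R5) OPTION L-ORD2 of res-L1-w45b-plan-1's ORDERS
2026-08-27T05:49:16Z («ORDER-2 CURVES RESOLVE IN ONE BLOW-UP, GENERICALLY: ring level, `R` regular,
`I` with `R/I` regular of dim 1, `F ∈ I²`: (a) criterion `Bl_I(R/F)` regular over `z ∈ V(I)` …, (b) the
generic member of the `𝔭²`-system satisfies it»), continuing the H-L0b files
`…OccursAsSingularLocus` (p500339), `…OrdTwo` (p500916), `…Transversal` (p502343). Part 2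
(`…OrdTwoOneBlowupGeneric`) assembles both charts and the headline.

**Setting.** `A` a `k`-algebra; `x = (x₀, x₁)`, `I = (x₀, x₁)`; `{i, j} = {0, 1}`; the affine chart
`A[I/xᵢ] ⊆ A[1/xᵢ]` of the blow-up of `Spec A` along `V(I)` (tree `blowupAlgebra`,
`T = x_j/xᵢ = blowupAlgebra.frac x i j`); a PRESENTED member `u = a x_j² + b x_j xᵢ + c xᵢ²` of `I²`,
and presented systems `u_l = a_l x_j² + b_l x_j xᵢ + c_l xᵢ²`, `s_t = Σ t_l u_l` (`linComb`).

* `algebraMap_presented_eq_sq_mul`, `algebraMap_linComb_eq_sq_mul_linComb` — CONTROLLED TRANSFORM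
  `u = xᵢ² (a T² + b T + c)`; `s_t = xᵢ² s′_t`, `s′_t = Σ t_l (a_l T² + b_l T + c_l)`: **the controlled
  transforms of a linear system form a linear system on the blow-up chart**;
* `ker_mapQuotient_eq_span_presented` — STRICT `=` CONTROLLED for `I` a quasi-regular prime and
  `b ∉ I`: the kernel of `A[I/xᵢ] → (A/(u))[Ī/x̄ᵢ]` (chart ring of `Bl_{V(I)} V(u)`, tree
  `blowupAlgebra.mapQuotient`) is `(a T² + b T + c)` (McCoy, via `EquimultipleAlongTrace`'s
  `controlledTransform_regular_mod_of_coeff` + `ker_mapQuotient_eq_span_of_regular_mod`);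
* `adjoin_range_chartTransform_eq_top`, `surjective_linCombQuotSq_chartTransform` — a system
  containing `x_j xᵢ`, `xᵢ²`, `g xᵢ²` (`g` over `k`-algebra generators) transforms to one containing
  `T`, `1`, `g`, which generates `A[I/xᵢ] = A[T]` over `k` and so SEPARATES TANGENT VECTORS at every
  closed point of the chart (`k = k̄`; tree `surjective_linCombQuotSq_of_adjoin_eq_top`);
* `isRegularRing_quotient_span_singleton_of_forall_isMaximal` — `B ⧸ (f)` is a regular ring once
  every `B_𝔐 ⧸ (f)` (`𝔐 ∋ f` maximal) is (`BertiniAffine.locQuotEquiv`; Matsumura 19.3 via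
  `isRegularRing_of_isRegularLocalRing_maximal`);
* `isGeneric_isRegularRing_blowup_chart` — **BERTINI UPSTAIRS**: for `A` regular of finite type over
  `k = k̄` and `I` a quasi-regular prime with `A/I` regular, `A[I/xᵢ]` is regular (Liu 8.1.19 (a),
  tree `blowupAlgebra.isRegularRing`), so the tree's affine Bertini
  `BertiniAffine.isGeneric_isRegularLocalRing_quotient_linComb` (Hartshorne II 8.18) applied to the
  transformed system gives, for GENERIC `t`: kernel `= (s′_t)`, `A[I/xᵢ] ⧸ (s′_t)` regular, and **the
  chart ring `(A/(s_t))[Ī/x̄ᵢ]` of `Bl_{V(I)} V(s_t)` is a regular ring**. The ORDER's pointwise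
  criterion (a) («regular over `z ∈ V(I)` unless a tangent direction kills `q̄_z, q̄′_z, ∇_Σ q_z,
  F̄₃,z`») is the Jacobian reading of `s′ ∉ 𝔐²` at exceptional closed points; its dimension count (b)
  is exactly Bertini's, run on the blow-up, which is what is kernel-checked here.

References: [Hartshorne1977] II Thm. 8.18; [Liu2002] Thm. 8.1.19 (a); [Matsumura1987] Thm. 19.3;
[GortzWedhorn2020] Prop. 13.96 (2), p. 416; [StacksProject] 052Q, 0BIQ. [folklore]-level commutative
algebra over the tree; axioms standard. AI-produced formalisation, weaker than expert review.
-/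

set_option linter.dupNamespace false -- mandated namespace `Summit.<Summit>.<Problem>` of this single-conjunct summit

noncomputable section

open IsLocalRing MvPolynomial

universe u v

namespace Summit.ResolutionOfSingularities.ResolutionOfSingularities.Cruxes.EquisingularLiftNat.Sections

open Literature.AlgebraicGeometry.Resolution Literature.AlgebraicGeometry.Resolution.BertiniAffine

variable {k : Type u} [Field k] {A : Type u} [CommRing A] [Algebra k A]
variable {ι : Type v} [Fintype ι]

/-! ## The chart `A[I/xᵢ]` of the blow-up along `I = (x₀, x₁)` and the controlled transform of a
presented member `u = a·x_j² + b·x_j xᵢ + c·xᵢ²` -/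

section Chart

variable (x : Fin 2 → A) (i j : Fin 2)

omit [Algebra k A] in
/-- On the chart `A[I/xᵢ]`: `x_j = xᵢ · (x_j/xᵢ)`. [folklore] -/
theorem algebraMap_eq_mul_frac :
    algebraMap A (blowupAlgebra (Ideal.span (Set.range x)) (x i)) (x j) =
      algebraMap A (blowupAlgebra (Ideal.span (Set.range x)) (x i)) (x i) *
        blowupAlgebra.frac x i j :=
  (blowupAlgebra.algebraMap_mul_gen _ _ _ _).symm

omit [Algebra k A] in
/-- **The controlled transform of a presented member.** For `u = a x_j² + b x_j xᵢ + c xᵢ²` one has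
`u = xᵢ² · (a T² + b T + c)` on `A[I/xᵢ]`, `T = x_j/xᵢ`. [cite: StacksProject, Tag 052Q] -/
theorem algebraMap_presented_eq_sq_mul (a b c u : A)
    (hu : u = a * x j ^ 2 + b * (x j * x i) + c * x i ^ 2) :
    algebraMap A (blowupAlgebra (Ideal.span (Set.range x)) (x i)) u =
      algebraMap A (blowupAlgebra (Ideal.span (Set.range x)) (x i)) (x i) ^ 2 *
        (algebraMap A _ a * blowupAlgebra.frac x i j ^ 2 +
          algebraMap A _ b * blowupAlgebra.frac x i j + algebraMap A _ c) := by
  rw [hu]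
  simp only [map_add, map_mul, map_pow, algebraMap_eq_mul_frac x i j]
  ring

/-- **The controlled transforms of a presented system form a linear system on the chart**:
`s_t = xᵢ² · s′_t` with `s′_t = Σ t_l (a_l T² + b_l T + c_l)`. [folklore] -/
theorem algebraMap_linComb_eq_sq_mul_linComb (u a b c : ι → A)
    (hu : ∀ l, u l = a l * x j ^ 2 + b l * (x j * x i) + c l * x i ^ 2) (t : ι → k) :
    algebraMap A (blowupAlgebra (Ideal.span (Set.range x)) (x i)) (linComb u t) =
      algebraMap A (blowupAlgebra (Ideal.span (Set.range x)) (x i)) (x i) ^ 2 *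
        linComb (fun l => algebraMap A (blowupAlgebra (Ideal.span (Set.range x)) (x i)) (a l) *
            blowupAlgebra.frac x i j ^ 2 +
          algebraMap A _ (b l) * blowupAlgebra.frac x i j + algebraMap A _ (c l)) t := by
  rw [← linComb_comp_algebraMap]
  simp only [linComb, algebraMap_presented_eq_sq_mul x i j _ _ _ _ (hu _), Finset.mul_sum,
    mul_smul_comm]

omit [Algebra k A] in
/-- The presented member in the NORMAL FORM of `EquimultipleAlongTrace` (`m = 2`, `z = xᵢ`,
`g = x_j`, coefficients `(c, b, a)`): the remainder is `0 ∈ I³`. [folklore] -/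
theorem presented_sub_normalForm_mem (a b c u : A)
    (hu : u = a * x j ^ 2 + b * (x j * x i) + c * x i ^ 2) :
    u - ∑ l ∈ Finset.range (2 + 1),
        (fun l : ℕ => if l = 0 then c else if l = 1 then b else a) l * x i ^ (2 - l) * x j ^ l ∈
      Ideal.span (Set.range x) ^ (2 + 1) := by
  have h : u - ∑ l ∈ Finset.range (2 + 1),
      (fun l : ℕ => if l = 0 then c else if l = 1 then b else a) l * x i ^ (2 - l) * x j ^ l = 0 := by
    rw [hu, Finset.sum_range_succ, Finset.sum_range_succ, Finset.sum_range_succ,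
      Finset.sum_range_zero]
    simp only [zero_add, if_true, one_ne_zero, if_false, show (2 : ℕ) ≠ 0 from two_ne_zero,
      show (2 : ℕ) ≠ 1 from by decide, Nat.sub_zero, pow_zero, mul_one, Nat.sub_self, pow_one,
      show 2 - 1 = 1 from rfl]
    ring
  rw [h]
  exact Ideal.zero_mem _


/-! ## Strict transform `=` controlled transform for members with `b ∉ I` -/

omit [Algebra k A] in
/-- **The strict transform of a presented member is cut out by its controlled transform** when
`I = (x₀, x₁)` is a quasi-regular prime and the mixed coefficient `b ∉ I`: the kernel of the chart
map `A[I/xᵢ] → (A/(u))[Ī/x̄ᵢ]` onto the chart ring of the blow-up of the hypersurface `V(u)` along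
`V(I)` is `(a T² + b T + c)` (McCoy: the leading form `c̄ + b̄ T + ā T²` is a non-zero-divisor of
`(A/I)[T]`; then `EquimultipleAlongTrace`'s `ker_mapQuotient_eq_span_of_regular_mod`).
[cite: GortzWedhorn2020, Prop. 13.96 (2) and p. 416] [OURS · L1 W4.5b] -/
theorem ker_mapQuotient_eq_span_presented (hji : j ≠ i) (hx : IsQuasiRegular x)
    [(Ideal.span (Set.range x)).IsPrime] (a b c u : A)
    (hu : u = a * x j ^ 2 + b * (x j * x i) + c * x i ^ 2) (hb : b ∉ Ideal.span (Set.range x)) :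
    RingHom.ker (blowupAlgebra.mapQuotient (Ideal.span (Set.range x)) (x i) (Ideal.span {u})) =
      Ideal.span {algebraMap A (blowupAlgebra (Ideal.span (Set.range x)) (x i)) a *
          blowupAlgebra.frac x i j ^ 2 +
        algebraMap A _ b * blowupAlgebra.frac x i j + algebraMap A _ c} := by
  have hF' := algebraMap_presented_eq_sq_mul x i j a b c u hu
  refine ker_mapQuotient_eq_span_of_regular_mod (Ideal.span (Set.range x)) (x i) hF' ?_
  refine controlledTransform_regular_mod_of_coeff x i j hx hji 2
    (fun l : ℕ => if l = 0 then c else if l = 1 then b else a)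
    (presented_sub_normalForm_mem x i j a b c u hu) hF' fun c' hc' => ?_
  have h1 := hc' 1 (by simp)
  simp only [one_ne_zero, if_false, if_true] at h1
  exact ((Ideal.IsPrime.mem_or_mem inferInstance h1).resolve_right hb)

/-! ## The chart ring upstairs: finite type, regular, and the transformed system separates
tangent vectors -/

/-- `A[I/xᵢ]` is of finite type over `k` when `A` is. [folklore] -/
theorem finiteType_blowupAlgebra_pair [Algebra.FiniteType k A] :
    Algebra.FiniteType k (blowupAlgebra (Ideal.span (Set.range x)) (x i)) :=
  haveI := finiteType_blowupAlgebra_span_range x i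
  Algebra.FiniteType.trans (S := A) inferInstance inferInstance

omit [Fintype ι] in
/-- **The transformed system generates the chart ring**: if the presented system contains the
members `g · xᵢ²` for `g` in a set of `k`-algebra generators of `A` and the member `x_j xᵢ`, then the
controlled transforms `a_l T² + b_l T + c_l` (among them the `g` and `T`) generate `A[I/xᵢ] = A[T]`
as a `k`-algebra. [folklore] [OURS · L1 W4.5b] -/
theorem adjoin_range_chartTransform_eq_top (hji : j ≠ i) (a b c : ι → A)
    (hT : ∃ l, a l = 0 ∧ b l = 1 ∧ c l = 0)
    (hrich : ∃ s : Set A, Algebra.adjoin k s = ⊤ ∧ ∀ g ∈ s, ∃ l, a l = 0 ∧ b l = 0 ∧ c l = g) :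
    Algebra.adjoin k (Set.range fun l =>
        algebraMap A (blowupAlgebra (Ideal.span (Set.range x)) (x i)) (a l) *
            blowupAlgebra.frac x i j ^ 2 +
          algebraMap A _ (b l) * blowupAlgebra.frac x i j + algebraMap A _ (c l)) = ⊤ := by
  set B := blowupAlgebra (Ideal.span (Set.range x)) (x i) with hB
  set u' : ι → B := fun l => algebraMap A B (a l) * blowupAlgebra.frac x i j ^ 2 +
    algebraMap A B (b l) * blowupAlgebra.frac x i j + algebraMap A B (c l) with hu'
  set S' := Algebra.adjoin k (Set.range u') with hS'
  obtain ⟨s, hs, hsg⟩ := hrich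
  -- the generators `g ∈ s` and `T` lie in `S'`
  have hg : ∀ g ∈ s, algebraMap A B g ∈ S' := by
    intro g hg
    obtain ⟨l, ha, hb, hc⟩ := hsg g hg
    have h : u' l = algebraMap A B g := by
      simp only [hu', ha, hb, hc, map_zero, zero_mul, zero_add]
    exact h ▸ Algebra.subset_adjoin ⟨l, rfl⟩
  have hTm : blowupAlgebra.frac x i j ∈ S' := by
    obtain ⟨l, ha, hb, hc⟩ := hT
    have h : u' l = blowupAlgebra.frac x i j := by
      simp only [hu', ha, hb, hc, map_zero, zero_mul, zero_add, map_one, one_mul, add_zero]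
    exact h ▸ Algebra.subset_adjoin ⟨l, rfl⟩
  -- hence the image of `A`
  have hA : ∀ r : A, algebraMap A B r ∈ S' := by
    intro r
    have hr : r ∈ Algebra.adjoin k s := hs ▸ Algebra.mem_top
    have hle : Algebra.adjoin k ((IsScalarTower.toAlgHom k A B) '' s) ≤ S' :=
      Algebra.adjoin_le (by rintro _ ⟨g, hg', rfl⟩; exact hg g hg')
    refine hle ?_
    rw [← AlgHom.map_adjoin]
    exact Subalgebra.mem_map.mpr ⟨r, hr, rfl⟩
  -- every element of `A[I/xᵢ]` is a polynomial over `A` in `T`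
  have key : ∀ P, blowupAlgebra.eval x i P ∈ S' := by
    intro P
    induction P using MvPolynomial.induction_on with
    | C r => rw [blowupAlgebra.eval_C]; exact hA r
    | add p q hp hq => rw [map_add]; exact add_mem hp hq
    | mul_X p l hp =>
      rw [map_mul, blowupAlgebra.eval_X]
      have hl : l.1 = j := fin_two_eq_of_ne_of_ne i l.1 j l.2 hji
      rw [hl]
      exact mul_mem hp hTm
  refine top_le_iff.mp fun z _ => ?_
  obtain ⟨P, rfl⟩ := blowupAlgebra.eval_surjective x i z
  exact key P

/-- **The transformed system separates tangent vectors at every closed point of the chart**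
(it generates `A[I/xᵢ]` over `k` and contains `1`, the transform of the member `xᵢ²`).
[folklore] [OURS · L1 W4.5b] -/
theorem surjective_linCombQuotSq_chartTransform [IsAlgClosed k] [Algebra.FiniteType k A]
    (hji : j ≠ i) (a b c : ι → A)
    (hT : ∃ l, a l = 0 ∧ b l = 1 ∧ c l = 0) (h1 : ∃ l, a l = 0 ∧ b l = 0 ∧ c l = 1)
    (hrich : ∃ s : Set A, Algebra.adjoin k s = ⊤ ∧ ∀ g ∈ s, ∃ l, a l = 0 ∧ b l = 0 ∧ c l = g)
    (𝔐 : Ideal (blowupAlgebra (Ideal.span (Set.range x)) (x i))) [𝔐.IsMaximal] :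
    Function.Surjective (linCombQuotSq (k := k) (fun l =>
        algebraMap A (blowupAlgebra (Ideal.span (Set.range x)) (x i)) (a l) *
            blowupAlgebra.frac x i j ^ 2 +
          algebraMap A _ (b l) * blowupAlgebra.frac x i j + algebraMap A _ (c l)) 𝔐) := by
  haveI := finiteType_blowupAlgebra_pair (k := k) x i
  obtain ⟨l₁, ha, hb, hc⟩ := h1
  refine surjective_linCombQuotSq_of_adjoin_eq_top _
    (adjoin_range_chartTransform_eq_top (k := k) x i j hji a b c hT hrich) (j₀ := l₁) ?_ 𝔐
  simp only [ha, hb, hc, map_zero, zero_mul, zero_add, map_one]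

end Chart

/-! ## From «regular at every closed point of the hypersurface» to «the hypersurface ring is a
regular ring» -/

omit [Algebra k A] in
/-- **A hypersurface regular at all its closed points is a regular ring**: for a Noetherian ring
`B` and `f ∈ B`, if `B_𝔐 ⧸ (f)` is a regular local ring for every maximal `𝔐 ∋ f`, then `B ⧸ (f)`
is a regular ring (its local rings at maximal ideals are the `B_𝔐 ⧸ (f)` — localisation commutes
with quotients — and regularity at maximal ideals suffices, Matsumura Thm. 19.3).
[cite: Matsumura1987, Thm. 19.3] [OURS · L1 W4.5b] -/
theorem isRegularRing_quotient_span_singleton_of_forall_isMaximal {B : Type u} [CommRing B]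
    [IsNoetherianRing B] (f : B)
    (h : ∀ (𝔐 : Ideal B) [𝔐.IsMaximal], f ∈ 𝔐 →
      IsRegularLocalRing (Localization.AtPrime 𝔐 ⧸
        Ideal.span {algebraMap B (Localization.AtPrime 𝔐) f})) :
    IsRegularRing (B ⧸ Ideal.span {f}) := by
  refine isRegularRing_of_isRegularLocalRing_maximal fun 𝔑 h𝔑 => ?_
  -- `𝔑 = 𝔐 / (f)` for the maximal ideal `𝔐 = 𝔑 ∩ B ⊇ (f)`
  obtain ⟨𝔐, h𝔐, hle, rfl⟩ : ∃ 𝔐 : Ideal B, 𝔐.IsMaximal ∧ Ideal.span {f} ≤ 𝔐 ∧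
      𝔐.map (Ideal.Quotient.mk (Ideal.span {f})) = 𝔑 := by
    refine ⟨𝔑.comap (Ideal.Quotient.mk (Ideal.span {f})),
      Ideal.comap_isMaximal_of_surjective _ Ideal.Quotient.mk_surjective, fun g hg => ?_,
      Ideal.map_comap_of_surjective _ Ideal.Quotient.mk_surjective 𝔑⟩
    rw [Ideal.mem_comap, Ideal.Quotient.eq_zero_iff_mem.mpr hg]
    exact 𝔑.zero_mem
  haveI := h𝔐
  -- `(B/(f))_𝔑 ≅ B_𝔐 / (f)`
  have hreg := h 𝔐 (hle (Ideal.mem_span_singleton_self f))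
  have hmap : (Ideal.span {f}).map (algebraMap B (Localization.AtPrime 𝔐)) =
      Ideal.span {algebraMap B (Localization.AtPrime 𝔐) f} := by
    rw [Ideal.map_span, Set.image_singleton]
  haveI : IsRegularLocalRing (Localization.AtPrime 𝔐 ⧸
      (Ideal.span {f}).map (algebraMap B (Localization.AtPrime 𝔐))) :=
    IsRegularLocalRing.of_ringEquiv (R := Localization.AtPrime 𝔐 ⧸
      Ideal.span {algebraMap B (Localization.AtPrime 𝔐) f}) (Ideal.quotEquivOfEq hmap.symm)
  exact IsRegularLocalRing.of_ringEquiv (locQuotEquiv (Ideal.span {f}) 𝔐 hle).toRingEquiv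

section Chart

variable (x : Fin 2 → A) (i j : Fin 2)

/-- **Bertini upstairs ⇒ the strict transform is a regular ring, chart by chart.** For `A`
regular of finite type over `k = k̄`, `I = (x₀, x₁)` a quasi-regular prime with `A/I` regular (a
smooth irreducible centre), and a presented `I²`-system containing the members `x_j xᵢ`, `xᵢ²` and
`g xᵢ²` (`g` over `k`-algebra generators of `A`): on the regular chart `A[I/xᵢ]` (Liu 8.1.19 (a))
the controlled transforms `s′_t = a_t T² + b_t T + c_t` form a linear system separating tangent
vectors, so by the tree's affine Bertini theorem (Hartshorne II 8.18) the hypersurface `V(s′_t)`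
is regular at every closed point for generic `t`; and `b_t ∉ I` for generic `t`, so `(s′_t)` IS
the strict transform of `V(s_t)` (`ker_mapQuotient_eq_span_presented`). Conclusion, for GENERIC
`t`: the kernel of `A[I/xᵢ] → (A/(s_t))[Ī/x̄ᵢ]` is `(s′_t)`, `A[I/xᵢ] ⧸ (s′_t)` is a regular ring,
and **the chart ring `(A/(s_t))[Ī/x̄ᵢ]` of the blow-up of the hypersurface `V(s_t)` along `V(I)`
is a regular ring**. [cite: Hartshorne1977, II Thm. 8.18] [cite: Liu2002, Thm. 8.1.19 (a)]
[cite: Matsumura1987, Thm. 19.3] [OURS · L1 W4.5b] helper L-ORD2 toward `stub_elnat_three` of crux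
`EquisingularLiftNat` (stmt-ResolutionOfSingularities-20038); NOT a statement of the manuscript. -/
theorem isGeneric_isRegularRing_blowup_chart [IsAlgClosed k] [IsRegularRing A]
    [Algebra.FiniteType k A] (hji : j ≠ i) (hx : IsQuasiRegular x)
    [(Ideal.span (Set.range x)).IsPrime] [IsRegularRing (A ⧸ Ideal.span (Set.range x))]
    (u a b c : ι → A) (hu : ∀ l, u l = a l * x j ^ 2 + b l * (x j * x i) + c l * x i ^ 2)
    (hT : ∃ l, a l = 0 ∧ b l = 1 ∧ c l = 0) (h1 : ∃ l, a l = 0 ∧ b l = 0 ∧ c l = 1)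
    (hrich : ∃ s : Set A, Algebra.adjoin k s = ⊤ ∧ ∀ g ∈ s, ∃ l, a l = 0 ∧ b l = 0 ∧ c l = g) :
    IsGeneric fun t : ι → k =>
      RingHom.ker (blowupAlgebra.mapQuotient (Ideal.span (Set.range x)) (x i)
          (Ideal.span {linComb u t})) =
        Ideal.span {linComb (fun l => algebraMap A (blowupAlgebra (Ideal.span (Set.range x)) (x i))
            (a l) * blowupAlgebra.frac x i j ^ 2 +
          algebraMap A _ (b l) * blowupAlgebra.frac x i j + algebraMap A _ (c l)) t} ∧
      IsRegularRing (blowupAlgebra (Ideal.span (Set.range x)) (x i) ⧸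
        Ideal.span {linComb (fun l => algebraMap A (blowupAlgebra (Ideal.span (Set.range x)) (x i))
            (a l) * blowupAlgebra.frac x i j ^ 2 +
          algebraMap A _ (b l) * blowupAlgebra.frac x i j + algebraMap A _ (c l)) t}) ∧
      IsRegularRing (blowupAlgebra ((Ideal.span (Set.range x)).map
          (Ideal.Quotient.mk (Ideal.span {linComb u t})))
        (Ideal.Quotient.mk (Ideal.span {linComb u t}) (x i))) := by
  classical
  set B := blowupAlgebra (Ideal.span (Set.range x)) (x i) with hB
  haveI := finiteType_blowupAlgebra_pair (k := k) x i
  haveI := blowupAlgebra.isRegularRing x i hx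
  -- Bertini upstairs
  have hBert := isGeneric_isRegularLocalRing_quotient_linComb (k := k)
    (surjective_linCombQuotSq_chartTransform (k := k) x i j hji a b c hT h1 hrich)
  -- `b_t ∉ I` for generic `t` (the member `x_j xᵢ` has `b = 1`)
  obtain ⟨𝔪₀, h𝔪₀, hI𝔪₀⟩ :=
    Ideal.exists_le_maximal (Ideal.span (Set.range x)) (Ideal.IsPrime.ne_top inferInstance)
  haveI := h𝔪₀
  have hbgen : IsGeneric fun t : ι → k => linComb b t ∉ Ideal.span (Set.range x) := by
    obtain ⟨l, -, hb, -⟩ := hT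
    refine (isGeneric_linComb_notMem (k := k) b 𝔪₀ ⟨l, ?_⟩).mono fun t ht hmem => ht (hI𝔪₀ hmem)
    rw [hb]
    exact (Ideal.ne_top_iff_one 𝔪₀).1 h𝔪₀.ne_top
  refine (hBert.and hbgen).mono fun t ht => ?_
  obtain ⟨hreg, hb⟩ := ht
  -- strict transform `= (s′_t)`
  have hker := ker_mapQuotient_eq_span_presented x i j hji hx (linComb a t) (linComb b t)
    (linComb c t) (linComb u t) (linComb_presentation hu t) hb
  have hlin : algebraMap A B (linComb a t) * blowupAlgebra.frac x i j ^ 2 +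
      algebraMap A B (linComb b t) * blowupAlgebra.frac x i j + algebraMap A B (linComb c t) =
      linComb (fun l => algebraMap A B (a l) * blowupAlgebra.frac x i j ^ 2 +
        algebraMap A B (b l) * blowupAlgebra.frac x i j + algebraMap A B (c l)) t := by
    have hmapl : ∀ f : ι → A, algebraMap A B (linComb f t) = ∑ l, t l • algebraMap A B (f l) :=
      fun f => by rw [← linComb_comp_algebraMap]; rfl
    rw [hmapl a, hmapl b, hmapl c]
    simp only [linComb, Finset.sum_mul, Finset.sum_add_distrib, smul_mul_assoc, smul_add]
  rw [hlin] at hker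
  have hregB : IsRegularRing (B ⧸ Ideal.span {linComb (fun l => algebraMap A B (a l) *
      blowupAlgebra.frac x i j ^ 2 + algebraMap A B (b l) * blowupAlgebra.frac x i j +
      algebraMap A B (c l)) t}) :=
    isRegularRing_quotient_span_singleton_of_forall_isMaximal _ fun 𝔐 _ h𝔐 => hreg 𝔐 h𝔐
  refine ⟨hker, hregB, ?_⟩
  -- transport along `A[I/xᵢ] ⧸ ker ≅ (A/(s_t))[Ī/x̄ᵢ]`
  haveI := hregB
  exact IsRegularRing.of_ringEquiv (R := B ⧸ Ideal.span {linComb (fun l => algebraMap A B (a l) *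
      blowupAlgebra.frac x i j ^ 2 + algebraMap A B (b l) * blowupAlgebra.frac x i j +
      algebraMap A B (c l)) t})
    ((Ideal.quotEquivOfEq hker.symm).trans (RingHom.quotientKerEquivOfSurjective
      (blowupAlgebra.mapQuotient_surjective (Ideal.span (Set.range x)) (x i)
        (Ideal.span {linComb u t}))))

end Chart

end Summit.ResolutionOfSingularities.ResolutionOfSingularities.Cruxes.EquisingularLiftNat.Sections

end
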